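import Summits.HodgeConjecture.CorCM.Model.Universe2CupFacts
import Summits.HodgeConjecture.CorCM.Proofs.Pohlmann.FactorActDescent2
import HarnessLib

/-!
# F2 `Fact_factorActDescends` for the second model universe `Model2.universe₂`

Cell `pub-hodgecm2` (COR-CM), seat model-2 (gen 2).  The stage-1 package DERIVES F2 from `ModelAxioms`, N1, N3 and the
model fact `Fact_prodSection` (`Universe.fact_factorActDescends_of_prodSection`, port `Proofs/Pohlmann/FactorActDescent{1,2}`);
this file feeds that derivation with the `universe₂` theorems of `Model/Universe2CupFacts.lean` — the twin of the model of
record's `Model/FactorActDescends.lean`.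
-/

noncomputable section

namespace Summit.HodgeConjecture.CorCM

namespace Model2

open Literature.NumberTheory.Automorphic.PicardCM (BallQuotientUniformisedDatum CMAbelianVarietyRealised)
open Literature.AlgebraicGeometry.HodgeTheory


/-- **`Fact_prodSection`** for `universe₂`: both projections of every binary product of the iso-complete universe have
sections (`universe₂_prodSection`). [folklore] -/
theorem universe₂_fact_prodSection (hHD : exists_isReal_hodgeModel) (hI : hodgePQ_independent_of_hodgeModel)
    (hU : BallQuotientUniformisedDatum) (h₃ : CMAbelianVarietyRealised) : (universe₂ hHD hI hU h₃).Fact_prodSection :=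
  fun v w ↦ universe₂_prodSection hU h₃ v w

/-- **F2 `Fact_factorActDescends` for `universe₂`, given its `ModelAxioms`** (the package derivation fed with the
cell's N1, N3 and `Fact_prodSection` theorems for `universe₂`). [cite: Pohlmann1968, §1 Thm 1] -/
theorem universe₂_fact_factorActDescends (hHD : exists_isReal_hodgeModel) (hI : hodgePQ_independent_of_hodgeModel)
    (hU : BallQuotientUniformisedDatum) (h₃ : CMAbelianVarietyRealised) (M₂ : (universe₂ hHD hI hU h₃).ModelAxioms) :
    (universe₂ hHD hI hU h₃).Fact_factorActDescends :=
  Universe.fact_factorActDescends_of_prodSection M₂ (universe₂_fact_cupExterior hHD hI hU h₃)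
    (universe₂_fact_pull_H0 hHD hI hU h₃) (universe₂_fact_prodSection hHD hI hU h₃)

end Model2

end Summit.HodgeConjecture.CorCM

end
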